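import Summits.ResolutionOfSingularities.ResolutionOfSingularities.Theorems.FrobeniusClosingPatchingRelPerfectTwoPlanesPlaneTwoThree
import Summits.ResolutionOfSingularities.ResolutionOfSingularities.Theorems.FrobeniusClosingPatchingRelPerfectTwoPlanesExcCurveS
import HarnessLib

/-!
# Crux `PatchingRelPerfect` (stmt-ResolutionOfSingularities-16161), chain w52 — the rank-two member
# `f = x₀x₁ + x₂³`: the plane step with the POINT-AVATAR twist (repaired companion, design note Add. 9–10)

[OURS · L1 W5.2 · rung, assembly for the repaired companion] With the point avatar
`J_q = (x₀) + (x₁,x₂)(x₁,x₂,x₃) + (x₃³)` inserted into the companion (needed on `B₃`, design note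
NEXT-two-planes-cube.md Addenda 8–10, kit j286610), the image on `B₁`, `B₂` acquires one more factor
`(u)·(u, e₀)`: it has the shape `(u)ᵃ · ((J_i · (u,e₀)) · (u,e₀))`.  Blowing up `(u, e₀)` first
(`isRegular_of_isBlowup_mul_of_charts` applied to `J_i · (u,e₀)`), the extra `(u,e₀)` becomes the
exceptional Cartier divisor on each chart and is twisted off (Stacks 080B) before the chart towers of
`…TwoPlanesLevelTwo/LevelTwoS` (`tpPlane_chart_zero/_succ` of `…TwoPlanesPlane`).  PROVED:

* `map_span_range_plane_chart` — `(u,e₀)·𝒪 = (exceptional parameter)` on each chart of `Bl_{(u,e₀)}`;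
* `tpPlane_chartJq_zero`, `tpPlane_chartJq_succ` — the two charts after the exceptional twist;
* `isRegular_of_isBlowup_tpPlane_coreJq` — the core assembly for the shape `(u)ᵃ · ((J_i·(u,e₀))·(u,e₀))`
  under the chart-coordinate hypotheses of `…TwoPlanesPlane`;
* `isRegular_of_isBlowup_tpPlane_coreJq_two_three` (`i = 2, 3`, modulo `hQr hQ0`), `…_coreJq_two` — on `B₂`,
  unconditional (facts from `…PlaneFacts`, `…Hyperplane`, `…ExcCurveT`, `…ExcCurveS`).

The `S`-level image identity `(𝔪ᴺ·A·J_q·A₃·A₄·I)B_i = (u)^{N+9}·((J_i·(u,e₀))·(u,e₀))` (`i = 1, 2`) is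
left to the sequel.  Nothing here is a statement of the manuscript under review.

## References

* The Stacks Project, Tags 080A, 080B. [StacksProject]
-/

-- `Summit.<Summit>.<Sub>.Theorems` with `Sub = Summit` (single-conjunct summit, D-0017)
set_option linter.dupNamespace false

noncomputable section

open CategoryTheory CategoryTheory.Limits AlgebraicGeometry Literature.AlgebraicGeometry.Resolution
open IsLocalRing

namespace Summit.ResolutionOfSingularities.ResolutionOfSingularities.Theorems

namespace TwoPlanesRung

open ConeRung

universe u

section PlaneJq

variable {S : Type u} [CommRing S] [IsRegularLocalRing S] (x : Fin 4 → S)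
  (hx : Ideal.span (Set.range x) = IsLocalRing.maximalIdeal S)
  (hd : (IsLocalRing.maximalIdeal S).spanFinrank = 4) (i : Fin 4)

local notation3 "M" => Ideal.span (Set.range x)
local notation3 "fT" => x 0 * x 1 + x 2 ^ 3
local notation3 "B" => chartRing x i
local notation3 "φ" => chartBase x i
local notation3 "uB" => chartBase x i (x i)
local notation3 "e[" j "]" => chartGen x i j
/-- the strict transform `H♯ = e₀e₁ + u e₂³` of `f` -/
local notation3 (prettyPrint := false) "Hs" => chartGen x i 0 * chartGen x i 1 + chartBase x i (x i) * chartGen x i 2 ^ 3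
local notation3 "U" => Ideal.span {chartBase x i (x i)}
/-- the plane centre `(u, e₀)` as a chart family and its ideal -/
local notation3 (prettyPrint := false) "cc" => (Fin.cons (chartBase x i (x i)) (fun _ : Fin 1 => chartGen x i 0) : Fin 2 → chartRing x i)
local notation3 (prettyPrint := false) "II" => Ideal.span (Set.range
  (Fin.cons (chartBase x i (x i)) (fun _ : Fin 1 => chartGen x i 0) : Fin 2 → chartRing x i))
/-- the three later companion factors on `B_i` (divided by `u²` each) -/
local notation3 (prettyPrint := false) "J" => Ideal.span {chartGen x i 0 * chartGen x i 1, chartBase x i (x i)} *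
    (Ideal.span {chartGen x i 0 * chartGen x i 1 + chartBase x i (x i) * chartGen x i 2 ^ 3} ⊔
      Ideal.span {chartBase x i (x i)} * Ideal.span {chartGen x i 0} ⊔ Ideal.span {chartBase x i (x i)} ^ 2) *
    (Ideal.span {chartGen x i 0 * chartGen x i 1 + chartBase x i (x i) * chartGen x i 2 ^ 3} ⊔
      Ideal.span {chartBase x i (x i)} ^ 2)
/-- the exceptional-curve models of the two level-two charts -/
local notation3 (prettyPrint := false) "PP" => MvPolynomial {j : Fin 2 // j ≠ Fin.succ 0} (chartRing x i ⧸ II)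
local notation3 (prettyPrint := false) "gFlat" => (MvPolynomial.C (Ideal.Quotient.mk II (chartGen x i 1)) :
    MvPolynomial {j : Fin 2 // j ≠ Fin.succ 0} (chartRing x i ⧸ II))
  + MvPolynomial.X (⟨0, (Fin.succ_ne_zero 0).symm⟩ : {j : Fin 2 // j ≠ Fin.succ 0}) *
    MvPolynomial.C (Ideal.Quotient.mk II (chartGen x i 2 ^ 3))
local notation3 (prettyPrint := false) "XFlat" => (MvPolynomial.X (⟨0, (Fin.succ_ne_zero 0).symm⟩ : {j : Fin 2 // j ≠ Fin.succ 0}) :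
  MvPolynomial {j : Fin 2 // j ≠ Fin.succ 0} (chartRing x i ⧸ II))
local notation3 (prettyPrint := false) "PP₀" => MvPolynomial {j : Fin 2 // j ≠ 0} (chartRing x i ⧸ II)
local notation3 (prettyPrint := false) "hFlat" => MvPolynomial.X (⟨1, one_ne_zero_fin2⟩ : {j : Fin 2 // j ≠ 0}) *
    (MvPolynomial.C (Ideal.Quotient.mk II (chartGen x i 1)) : MvPolynomial {j : Fin 2 // j ≠ 0} (chartRing x i ⧸ II))
  + MvPolynomial.C (Ideal.Quotient.mk II (chartGen x i 2 ^ 3))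

omit [IsRegularLocalRing S] in
/-- On each chart of `Bl_{(u,e₀)} Spec B_i` the centre ideal becomes the exceptional parameter.
[cite: StacksProject, Tag 0804] -/
theorem map_span_range_plane_chart (k : Fin 2) :
    (II).map (chartBase cc k) = Ideal.span {chartBase cc k (cc k)} :=
  map_reesChartBase_eq (cc k) (Ideal.mem_span_range_self (f := cc) (x := k))

omit [IsRegularLocalRing S] in
/-- The `s`-chart of the plane blow-up, with the exceptional twist `(u,e₀)·𝒪 = (w₀)` removed first.
[cite: StacksProject, Tag 080B] -/
theorem tpPlane_chartJq_zero (hc : IsQuasiRegular cc) (hB : IsDomain B) (hBr : IsRegularRing B)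
    (hdII : IsDomain (B ⧸ II)) (hrII : IsRegularRing (B ⧸ II)) (hu0 : uB ≠ 0)
    (hQr : IsRegularRing (PP₀ ⧸ Ideal.span {hFlat})) (hQ0 : hFlat ≠ 0)
    {Y' : Scheme.{u}} {ρ' : Y' ⟶ Spec (.of (chartRing cc 0))}
    (h' : IsBlowup ρ' (affineBlowup.idealSheaf ((J * II).map (chartBase cc 0)))) : Scheme.IsRegular Y' := by
  have hJII : (J * II).map (chartBase cc 0) =
      Ideal.span {chartBase cc 0 (cc 0)} * (J).map (chartBase cc 0) :=
    ((Ideal.map_mul (chartBase cc 0) (J) (II)).trans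
      (congrArg (fun T => (J).map (chartBase cc 0) * T) (map_span_range_plane_chart x i 0))).trans
      (mul_comm _ _)
  rw [hJII] at h'
  exact CoreRungTower.isRegular_of_isBlowup_span_singleton_mul
    (reesChartBase_mem_nonZeroDivisors (cc 0) (Ideal.mem_span_range_self (f := cc) (x := 0))) _
    (fun Y'' ρ'' h'' => tpPlane_chart_zero x i hc hB hBr hdII hrII hu0 hQr hQ0 h'') h'

set_option maxHeartbeats 400000 in
omit [IsRegularLocalRing S] in
/-- The `t`-chart of the plane blow-up, with the exceptional twist `(u,e₀)·𝒪 = (w₁)` removed first.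
[cite: StacksProject, Tag 080B] -/
theorem tpPlane_chartJq_succ (hc : IsQuasiRegular cc) (hB : IsDomain B) (hBr : IsRegularRing B)
    (hdII : IsDomain (B ⧸ II)) (hrII : IsRegularRing (B ⧸ II)) (hdu : IsDomain (B ⧸ U))
    (hdy1 : IsDomain (B ⧸ Ideal.span {e[1]})) (hdIIy : IsDomain (B ⧸ (II ⊔ Ideal.span {e[1]})))
    (hdy : IsDomain (B ⧸ Ideal.span {uB, e[1]})) (hry : IsRegularRing (B ⧸ Ideal.span {uB, e[1]}))
    (hy : e[1] ∉ II) (hey : e[0] ∉ Ideal.span {e[1]}) (he : e[0] ∉ U) (heuy : e[0] ∉ U ⊔ Ideal.span {e[1]})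
    (hPd : IsDomain (PP ⧸ Ideal.span {gFlat})) (hPr : IsRegularRing (PP ⧸ Ideal.span {gFlat}))
    (hPX : XFlat ∉ Ideal.span {gFlat})
    {Y' : Scheme.{u}} {ρ' : Y' ⟶ Spec (.of (chartRing cc (Fin.succ 0)))}
    (h' : IsBlowup ρ' (affineBlowup.idealSheaf ((J * II).map (chartBase cc (Fin.succ 0))))) :
    Scheme.IsRegular Y' := by
  have hJII : (J * II).map (chartBase cc (Fin.succ 0)) =
      Ideal.span {chartBase cc (Fin.succ 0) (cc (Fin.succ 0))} * (J).map (chartBase cc (Fin.succ 0)) :=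
    ((Ideal.map_mul (chartBase cc (Fin.succ 0)) (J) (II)).trans
      (congrArg (fun T => (J).map (chartBase cc (Fin.succ 0)) * T)
        (map_span_range_plane_chart x i (Fin.succ 0)))).trans (mul_comm _ _)
  rw [hJII] at h'
  exact CoreRungTower.isRegular_of_isBlowup_span_singleton_mul
    (reesChartBase_mem_nonZeroDivisors (cc (Fin.succ 0))
      (Ideal.mem_span_range_self (f := cc) (x := Fin.succ 0))) _
    (fun Y'' ρ'' h'' => tpPlane_chart_succ x i hc hB hBr hdII hrII hdu hdy1 hdIIy hdy hry hy hey he heuy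
      hPd hPr hPX h'') h'

set_option maxHeartbeats 400000 in
include hx hd in
/-- **The plane step with the point-avatar twist — core form**: every blowing up of `Spec B_i` along
`(u)ᵃ · ((J_i · (u,e₀)) · (u,e₀))` is regular, given the chart-coordinate facts of `…TwoPlanesPlane`.
[cite: StacksProject, Tag 080A] [cite: StacksProject, Tag 080B] -/
theorem isRegular_of_isBlowup_tpPlane_coreJq (hi : i ≠ 0) (a : ℕ)
    (hdII : IsDomain (B ⧸ II)) (hdy1 : IsDomain (B ⧸ Ideal.span {e[1]}))
    (hdIIy : IsDomain (B ⧸ (II ⊔ Ideal.span {e[1]})))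
    (hdy : IsDomain (B ⧸ Ideal.span {uB, e[1]})) (hry : IsRegularRing (B ⧸ Ideal.span {uB, e[1]}))
    (hy : e[1] ∉ II) (hey : e[0] ∉ Ideal.span {e[1]}) (heuy : e[0] ∉ U ⊔ Ideal.span {e[1]})
    (hPd : IsDomain (PP ⧸ Ideal.span {gFlat})) (hPr : IsRegularRing (PP ⧸ Ideal.span {gFlat}))
    (hPX : XFlat ∉ Ideal.span {gFlat})
    (hQr : IsRegularRing (PP₀ ⧸ Ideal.span {hFlat})) (hQ0 : hFlat ≠ 0)
    {Y : Scheme.{u}} {ρ : Y ⟶ Spec (.of B)}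
    (hρ : IsBlowup ρ (affineBlowup.idealSheaf (Ideal.span {uB ^ a} * ((J * II) * II)))) :
    Scheme.IsRegular Y := by
  haveI : IsDomain S := isDomain_of_isRegularLocalRing S
  have hqr := isQuasiRegular_regularSystemOfParameters hd x hx
  have hBr : IsRegularRing B := isRegularRing_chart x hx hd i
  haveI := isRegularRing_residue x hx
  haveI := isDomain_residue x hx
  have hxi : x i ≠ 0 := (isRsopPart_comp_of_rsop hd x hx id Function.injective_id).ne_zero i
  have hB : IsDomain B := isDomain_chartRing x i hxi
  have hdu : IsDomain (B ⧸ U) := isDomain_chartRing_quot_span x i hqr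
  have hi0 : (0 : Fin 4) ≠ i := fun h => hi h.symm
  have hc : IsQuasiRegular cc :=
    isQuasiRegular_cons_chartGen x i (fun _ : Fin 1 => (⟨0, hi0⟩ : {j : Fin 4 // j ≠ i})) hqr
      (Function.injective_of_subsingleton _)
  have hrII : IsRegularRing (B ⧸ II) :=
    isRegularRing_quot_cons_chartGen x i (fun _ : Fin 1 => (⟨0, hi0⟩ : {j : Fin 4 // j ≠ i})) hqr
  have he : e[0] ∉ U := chartGen_notMem_span_u x hx hd i 0 hi0
  have hu : uB ∈ nonZeroDivisors B :=
    reesChartBase_mem_nonZeroDivisors (x i) (Ideal.mem_span_range_self (f := x) (x := i))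
  have hu0 : uB ≠ 0 := nonZeroDivisors.ne_zero hu
  have h0 := fun (Y' : Scheme.{u}) (ρ' : Y' ⟶ Spec (.of (chartRing cc 0)))
      (h' : IsBlowup ρ' (affineBlowup.idealSheaf ((J * II).map (chartBase cc 0)))) =>
    tpPlane_chartJq_zero x i hc hB hBr hdII hrII hu0 hQr hQ0 h'
  have h1 := fun (Y' : Scheme.{u}) (ρ' : Y' ⟶ Spec (.of (chartRing cc (Fin.succ 0))))
      (h' : IsBlowup ρ' (affineBlowup.idealSheaf ((J * II).map (chartBase cc (Fin.succ 0))))) =>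
    tpPlane_chartJq_succ x i hc hB hBr hdII hrII hdu hdy1 hdIIy hdy hry hy hey he heuy hPd hPr hPX h'
  have hcharts : ∀ (k : Fin 2) (Y' : Scheme.{u}) (ρ' : Y' ⟶ Spec (.of (chartRing cc k))),
      IsBlowup ρ' (affineBlowup.idealSheaf ((J * II).map (chartBase cc k))) → Scheme.IsRegular Y' :=
    Fin.forall_fin_two.mpr ⟨h0, h1⟩
  exact CoreRungTower.isRegular_of_isBlowup_span_singleton_mul (pow_mem hu a) _
    (fun Y' ρ' h' => isRegular_of_isBlowup_mul_of_charts cc (J * II) hcharts h') hρ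

include hx hd in
/-- **The plane step with the point-avatar twist on `B₂`, unconditional.**
[cite: StacksProject, Tag 080A] [cite: StacksProject, Tag 080B] -/
theorem isRegular_of_isBlowup_tpPlane_coreJq_two_three (hi : i ≠ 0) (hi1 : i ≠ 1) (a : ℕ)
    (hQr : IsRegularRing (PP₀ ⧸ Ideal.span {hFlat})) (hQ0 : hFlat ≠ 0)
    {Y : Scheme.{u}} {ρ : Y ⟶ Spec (.of B)}
    (hρ : IsBlowup ρ (affineBlowup.idealSheaf (Ideal.span {uB ^ a} * ((J * II) * II)))) :
    Scheme.IsRegular Y := by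
  obtain ⟨hPd, hPr, hPX⟩ := excCurveT_facts x hx hd i hi hi1
  exact isRegular_of_isBlowup_tpPlane_coreJq x hx hd i hi a (isDomain_quot_plane x hx hd i hi)
    (isDomain_quot_span_e1 x hx hd i hi1) (isDomain_quot_plane_sup_e1 x hx hd i hi hi1)
    (isDomain_quot_u_e1 x hx hd i hi1) (isRegularRing_quot_u_e1 x hx hd i hi1)
    (e1_notMem_plane x hx hd i hi hi1) (e0_notMem_span_e1 x hx hd i hi hi1)
    (e0_notMem_u_sup_e1 x hx hd i hi hi1) hPd hPr hPX hQr hQ0 hρ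

include hx hd in
/-- **The plane step with the point-avatar twist on `B₂`, unconditional** (all five exceptional-curve
facts from `…ExcCurveT`, `…ExcCurveS`). [cite: StacksProject, Tag 080A] [cite: StacksProject, Tag 080B] -/
theorem isRegular_of_isBlowup_tpPlane_coreJq_two (hi2 : i = 2) (a : ℕ)
    {Y : Scheme.{u}} {ρ : Y ⟶ Spec (.of B)}
    (hρ : IsBlowup ρ (affineBlowup.idealSheaf (Ideal.span {uB ^ a} * ((J * II) * II)))) :
    Scheme.IsRegular Y := by
  subst hi2
  exact isRegular_of_isBlowup_tpPlane_coreJq_two_three x hx hd 2 (by decide) (by decide) a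
    (excCurveS_isRegularRing_two x hx hd) (excCurveS_ne_zero_two x hx hd) hρ

end PlaneJq

end TwoPlanesRung

end Summit.ResolutionOfSingularities.ResolutionOfSingularities.Theorems

end
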